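import Summits.AtomisticToContinuum.HydrodynamicLimit.Theorems.InformationPercolationEngineCollisionRateReduction
import HarnessLib

/-!
# `InformationPercolationEngine.CollisionRate` (stmt-AtomisticToContinuum-13481): the composition at the unit mark from the
# marginal envelope (A) and the kinetic core IN PROBABILITY (T34p) — helper file RED′ of the crux line `Sketch`

Helper file (`--supports stmt-AtomisticToContinuum-13481`) of the crux line `Sketch` (lead prover-line-stmt-AtomisticToContinuum-13481-c8,
skeleton `Cruxes/CollisionRate/Lines/Sketch.lean` v26), companion of
`…/Theorems/InformationPercolationEngineCollisionRateReduction.lean`.  There the crux (the Enskog collision-frequency law for the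
deterministic hard-sphere flow at fixed reduced diameter `σ`) was reduced to (A) ∧ T34, the `L¹` hypothesis T34 being consumed ONLY
through a Markov step producing the in-probability smallness of the time-integrated even tube functional
`T = evenTubeTimeStat σ N (Φ N) τ χ g Ξ₁ᴸ r κ` at the speed-truncated unit mark `Ξ₁ᴸ q = speedCutoff L ‖v_k − v_j‖`.  This file
replaces T34 by that in-probability statement itself:

(T34p) KINETIC CORE IN PROBABILITY — Boltzmann's collision cylinder at flight-time resolution `κε` read on the evolved configurations
and integrated over `[0, τ]`, minus `σ³ ×` Enskog's prediction built from the same configurations' `r`-ball fields, is small in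
`LG`-probability: `LG{η < |T|} ≤ δ` for `N ≥ N₀(κ)`, `κ < κ₀(L)`, `L ≥ L₀(r)`, `r < r₀(η, δ)` (truncation level quantified
`∃ L₀, ∀ L, L₀ ≤ L → ∃ κ₀ …`, accuracies `∀ η δ`).  It is the weakest form of the kinetic core that the composition consumes; like T34
it is an OPEN PROBLEM at `t > 0` (Boltzmann–Enskog class for the deterministic flow at fixed `σ`), and nothing is claimed on it here.

* `stub_evenStatOne_of_evenTubeTimeStatProb` — **(A) → T34p → ESO**: `evenStat σ N (Φ N) τ χ g 1 r` is small in `LG`-probability,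
  `N → ∞` then `r → 0`; registered stub RED′ of the skeleton.  Proof = the composition of the Reduction file verbatim with the Markov
  block deleted: `evenStat(1) = [evenStat(1) − evenStat(Ξ₁ᴸ)] + [evenStat(Ξ₁ᴸ) − T] + T`, the three terms small in probability by
  the landed links T1 `stub_unitMarkTruncation` (`…CollisionRateUnitMarkTruncation.lean`), T2 = T2red
  `stub_cylinderPullbackUnit_of_residuals` ∘ (T2a `stub_continuityCorrectionLG`, T2b′ `stub_shortFlightDeficitLG_of_flux` ∘ (F2
  `stub_collisionMarkFluxLG_of_envelope`, F3 `stub_fwdHitFluxLG_of_envelope`), T2c′ `stub_threeBodyCollisionSumLG_of_envelope`) — all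
  from (A), the tail support `CollisionMomentBound` (stmt-15144) consumed by T1 and T2a being derived from (A) through F2
  (`Theorems.CollisionMomentBound.collisionMomentBound_of_collisionMarkFlux`) — and the hypothesis T34p; thresholds
  `η₀ := min (min η₁ η₂) η₃`, `σ₀ := min (min σ₁ σ₂) σ₃`, accuracies `(η/3, δ/3)`, level `L := max (max L₀ L₃) 1` (T1 needs
  `L₀ ≤ L`, T34p needs `L₃ ≤ L`, T2 needs `1 ≤ L`), window `κ := min (κ₂/2) (κ₃/2)`, `N₀ := max`, union bound
  (`measure_mono`, `measure_union_le`, `abs_sub_abs_le_abs_sub`, `ENNReal.ofReal_add`).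
* `collisionRate_of_marginalEnvelope_of_evenTubeTimeStatProb` — **(A) → T34p → CollisionRate** through the tree bridge
  `collisionRate_of_evenStat_one` (the crux statistic is `evenStat` at the constant mark `1`).

(A) MARGINAL ENVELOPE OF THE EVOLVED LAW is stated verbatim as in the Reduction file (two- and three-particle labelled marginals of
`LG_t = (Φ_t)_# LG` dominated by `C × (Haar ⊗ N(u, θ))^{⊗k}`, `lintegral` form; Lanford-type a-priori bound, OPEN at `t > 0`).
No new definitions.  Not here: any claim on (A) or T34p, or the converse ESO → T34p.

References: H. van Beijeren, M. H. Ernst, Physica 68 (1973) 437; P. Résibois, J. Stat. Phys. 19 (1978) 593; H. Spohn, *Large Scale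
Dynamics of Interacting Particles* (1991), Part I §2.4, §3; C. Cercignani, R. Illner, M. Pulvirenti, *The Mathematical Theory of
Dilute Gases* (1994), §4.3.
-/

open scoped BigOperators Topology Classical MeasureTheory ProbabilityTheory InnerProductSpace ENNReal
open Filter Set Function MeasureTheory
open Literature.Analysis.FluidPDE Literature.MathematicalPhysics.KineticTheory

namespace Summit.AtomisticToContinuum.HydrodynamicLimit.Theorems.CollisionRate

open Summit.AtomisticToContinuum.HydrodynamicLimit.Theses.InformationPercolationEngine

noncomputable section

/-- **The general composition at the unit mark from (A) and the kinetic core in probability T34p.**  For the marginal envelope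
(A) of the evolved local Gibbs law and the in-probability smallness T34p of the time-integrated even tube functional
`evenTubeTimeStat σ N (Φ N) τ χ g Ξ₁ᴸ r κ` at the speed-truncated unit mark (both hypotheses; the registered stub RED′ of the line's
skeleton v26): `evenStat σ N (Φ N) τ χ g 1 r` is small in `LG`-probability, `N → ∞` then `r → 0`.  Chain: F2, F3 from (A);
`CollisionMomentBound` from F2; T2b′ from F2+F3; T2c′ from (A); T2a from CMB+T2b′; T2 from T2a/T2b′/T2c′; T1 from CMB; third term =
T34p; union bound with accuracies `(η/3, δ/3)` at level `L := max (max L₀ L₃) 1` and window `κ := min (κ₂/2) (κ₃/2)`. [folklore] -/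
theorem stub_evenStatOne_of_evenTubeTimeStatProb :
    (∀ (a₀ θ₀ : T3 → ℝ) (u₀ : T3 → V3), Continuous a₀ → Continuous θ₀ → Continuous u₀ →
      (∀ x, 0 < a₀ x) → (∀ x, 0 < θ₀ x) → ∃ σ₀ : ℝ, 0 < σ₀ ∧ ∀ σ : ℝ, 0 < σ → σ < σ₀ →
      ∀ Φ : (N : ℕ) → HardSphereFlow (Torus.geometry (Fin 3)) (hsDiameter σ N) (N + 1),
      ∀ τ : ℝ, 0 < τ → ∃ C : ℝ, 0 ≤ C ∧ ∃ u : V3, ∃ θ : ℝ, 0 < θ ∧ ∃ N₀ : ℕ, ∀ N : ℕ, N₀ ≤ N →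
      ∀ t ∈ Set.Icc (0 : ℝ) τ,
        (∀ i j : Fin (N + 1), i ≠ j → ∀ f : (T3 × V3) × (T3 × V3) → ℝ≥0∞, Measurable f →
          ∫⁻ z, f ((Φ N).flow t z i, (Φ N).flow t z j) ∂(localGibbsLaw σ a₀ u₀ θ₀ N (Φ N)) ≤
            ENNReal.ofReal C * ∫⁻ q, f q ∂(((volume : Measure T3).prod (gaussMeasure u θ)).prod
              ((volume : Measure T3).prod (gaussMeasure u θ)))) ∧
        (∀ i j k : Fin (N + 1), i ≠ j → i ≠ k → j ≠ k → ∀ f : (T3 × V3) × (T3 × V3) × (T3 × V3) → ℝ≥0∞, Measurable f →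
          ∫⁻ z, f ((Φ N).flow t z i, (Φ N).flow t z j, (Φ N).flow t z k) ∂(localGibbsLaw σ a₀ u₀ θ₀ N (Φ N)) ≤
            ENNReal.ofReal C * ∫⁻ q, f q ∂(((volume : Measure T3).prod (gaussMeasure u θ)).prod
              (((volume : Measure T3).prod (gaussMeasure u θ)).prod ((volume : Measure T3).prod (gaussMeasure u θ)))))) →
    (∃ η₀ : ℝ, 0 < η₀ ∧ ∀ (a₀ θ₀ : T3 → ℝ) (u₀ : T3 → V3), Continuous a₀ → Continuous θ₀ → Continuous u₀ →
      (∀ x, 0 < a₀ x) → (∀ x, 0 < θ₀ x) → ∃ σ₀ : ℝ, 0 < σ₀ ∧ ∀ σ : ℝ, 0 < σ → σ < σ₀ →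
      ∀ Φ : (N : ℕ) → HardSphereFlow (Torus.geometry (Fin 3)) (hsDiameter σ N) (N + 1),
      ∀ τ : ℝ, 0 < τ → ∀ χ : ℝ × T3 → ℝ, Continuous χ → ∀ g : ℝ → ℝ, Continuous g →
      (∀ x, η₀ ≤ x → g x = 0) →
      ∀ η δ : ℝ, 0 < η → 0 < δ → ∃ r₀ : ℝ, 0 < r₀ ∧ ∀ r : ℝ, 0 < r → r < r₀ →
      ∃ L₀ : ℝ, ∀ L : ℝ, L₀ ≤ L → ∃ κ₀ : ℝ, 0 < κ₀ ∧ ∀ κ : ℝ, 0 < κ → κ < κ₀ → ∃ N₀ : ℕ, ∀ N : ℕ, N₀ ≤ N →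
        localGibbsLaw σ a₀ u₀ θ₀ N (Φ N)
          {z | η < |evenTubeTimeStat σ N (Φ N) τ χ g (fun q : V3 × V3 × V3 => speedCutoff L ‖q.2.2 - q.2.1‖) r κ z|}
          ≤ ENNReal.ofReal δ) →
    ∃ η₀ : ℝ, 0 < η₀ ∧ ∀ (a₀ θ₀ : T3 → ℝ) (u₀ : T3 → V3), Continuous a₀ → Continuous θ₀ → Continuous u₀ →
      (∀ x, 0 < a₀ x) → (∀ x, 0 < θ₀ x) → ∃ σ₀ : ℝ, 0 < σ₀ ∧ ∀ σ : ℝ, 0 < σ → σ < σ₀ →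
      ∀ Φ : (N : ℕ) → HardSphereFlow (Torus.geometry (Fin 3)) (hsDiameter σ N) (N + 1),
      ∀ τ : ℝ, 0 < τ → ∀ χ : ℝ × T3 → ℝ, Continuous χ → ∀ g : ℝ → ℝ, Continuous g →
      (∀ a, η₀ ≤ a → g a = 0) →
      ∀ η δ : ℝ, 0 < η → 0 < δ → ∃ r₀ : ℝ, 0 < r₀ ∧ ∀ r : ℝ, 0 < r → r < r₀ →
      ∃ N₀ : ℕ, ∀ N : ℕ, N₀ ≤ N →
        localGibbsLaw σ a₀ u₀ θ₀ N (Φ N) {z | η < |evenStat σ N (Φ N) τ χ g (fun _ => 1) r z|}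
          ≤ ENNReal.ofReal δ := by
  intro hA hT34p
  -- the landed links of the chain
  have hF2 := stub_collisionMarkFluxLG_of_envelope hA
  have hF3 := stub_fwdHitFluxLG_of_envelope hA
  have hCMB : CollisionMomentBound :=
    Summit.AtomisticToContinuum.HydrodynamicLimit.Theorems.CollisionMomentBound.collisionMomentBound_of_collisionMarkFlux hF2
  have hT2b := stub_shortFlightDeficitLG_of_flux hF2 hF3
  have hT2 := stub_cylinderPullbackUnit_of_residuals (stub_continuityCorrectionLG hCMB hT2b) hT2b
    (stub_threeBodyCollisionSumLG_of_envelope hA)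
  obtain ⟨η₁, hη₁, H1⟩ := stub_unitMarkTruncation hCMB
  obtain ⟨η₂, hη₂, H2⟩ := hT2
  obtain ⟨η₃, hη₃, H3⟩ := hT34p
  refine ⟨min (min η₁ η₂) η₃, lt_min (lt_min hη₁ hη₂) hη₃, ?_⟩
  intro a₀ θ₀ u₀ ha hθ hu ha0 hθ0
  obtain ⟨σ₁, hσ₁, H1⟩ := H1 a₀ θ₀ u₀ ha hθ hu ha0 hθ0
  obtain ⟨σ₂, hσ₂, H2⟩ := H2 a₀ θ₀ u₀ ha hθ hu ha0 hθ0
  obtain ⟨σ₃, hσ₃, H3⟩ := H3 a₀ θ₀ u₀ ha hθ hu ha0 hθ0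
  refine ⟨min (min σ₁ σ₂) σ₃, lt_min (lt_min hσ₁ hσ₂) hσ₃, ?_⟩
  intro σ hσ hσlt Φ τ hτ χ hχ g hg hg0 η δ hη hδ
  have hσ1 : σ < σ₁ := lt_of_lt_of_le hσlt ((min_le_left _ _).trans (min_le_left _ _))
  have hσ2 : σ < σ₂ := lt_of_lt_of_le hσlt ((min_le_left _ _).trans (min_le_right _ _))
  have hσ3 : σ < σ₃ := lt_of_lt_of_le hσlt (min_le_right _ _)
  -- the cutoff vanishes above each threshold
  have hg1 : ∀ x, η₁ ≤ x → g x = 0 := fun x h => hg0 x (((min_le_left _ _).trans (min_le_left _ _)).trans h)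
  have hg2 : ∀ x, η₂ ≤ x → g x = 0 := fun x h => hg0 x (((min_le_left _ _).trans (min_le_right _ _)).trans h)
  have hg3 : ∀ x, η₃ ≤ x → g x = 0 := fun x h => hg0 x ((min_le_right _ _).trans h)
  -- accuracies
  have hη3 : 0 < η / 3 := by positivity
  have hδ3 : 0 < δ / 3 := by positivity
  obtain ⟨r₁, hr₁, H1⟩ := H1 σ hσ hσ1 Φ τ hτ χ hχ g hg hg1 (η / 3) (δ / 3) hη3 hδ3
  obtain ⟨r₂, hr₂, H2⟩ := H2 σ hσ hσ2 Φ τ hτ χ hχ g hg hg2 (η / 3) (δ / 3) hη3 hδ3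
  obtain ⟨r₃, hr₃, H3⟩ := H3 σ hσ hσ3 Φ τ hτ χ hχ g hg hg3 (η / 3) (δ / 3) hη3 hδ3
  refine ⟨min (min r₁ r₂) r₃, lt_min (lt_min hr₁ hr₂) hr₃, ?_⟩
  intro r hr hrlt
  have hr1 : r < r₁ := lt_of_lt_of_le hrlt ((min_le_left _ _).trans (min_le_left _ _))
  have hr2 : r < r₂ := lt_of_lt_of_le hrlt ((min_le_left _ _).trans (min_le_right _ _))
  have hr3 : r < r₃ := lt_of_lt_of_le hrlt (min_le_right _ _)
  -- truncation level: T1 needs `L₀ ≤ L`, T34p needs `L₃ ≤ L`, T2 needs `1 ≤ L`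
  obtain ⟨L₀, H1⟩ := H1 r hr hr1
  obtain ⟨L₃, H3⟩ := H3 r hr hr3
  have hL₀ : L₀ ≤ max (max L₀ L₃) 1 := (le_max_left _ _).trans (le_max_left _ _)
  have hL3 : L₃ ≤ max (max L₀ L₃) 1 := (le_max_right _ _).trans (le_max_left _ _)
  have hL1 : (1 : ℝ) ≤ max (max L₀ L₃) 1 := le_max_right _ _
  obtain ⟨N₁, H1⟩ := H1 (max (max L₀ L₃) 1) hL₀
  -- flight-time window (T2 and T34p each give a κ₀)
  obtain ⟨κ₂, hκ₂, H2⟩ := H2 r hr hr2 (max (max L₀ L₃) 1) hL1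
  obtain ⟨κ₃, hκ₃, H3⟩ := H3 (max (max L₀ L₃) 1) hL3
  have hκpos : (0 : ℝ) < min (κ₂ / 2) (κ₃ / 2) := lt_min (by positivity) (by positivity)
  have hκlt2 : min (κ₂ / 2) (κ₃ / 2) < κ₂ := lt_of_le_of_lt (min_le_left _ _) (by linarith)
  have hκlt3 : min (κ₂ / 2) (κ₃ / 2) < κ₃ := lt_of_le_of_lt (min_le_right _ _) (by linarith)
  obtain ⟨N₂, H2⟩ := H2 (min (κ₂ / 2) (κ₃ / 2)) hκpos hκlt2
  obtain ⟨N₃, H3⟩ := H3 (min (κ₂ / 2) (κ₃ / 2)) hκpos hκlt3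
  refine ⟨max N₁ (max N₂ N₃), fun N hN => ?_⟩
  have hN1 : N₁ ≤ N := (le_max_left _ _).trans hN
  have hN2 : N₂ ≤ N := ((le_max_left _ _).trans (le_max_right _ _)).trans hN
  have hN3 : N₃ ≤ N := ((le_max_right _ _).trans (le_max_right _ _)).trans hN
  have E1 := H1 N hN1
  have E2 := H2 N hN2
  have E3 := H3 N hN3
  -- the union bound
  set P := localGibbsLaw σ a₀ u₀ θ₀ N (Φ N) with hP
  set D := fun z => evenStat σ N (Φ N) τ χ g (fun _ => 1) r z with hD
  set DL := fun z => evenStat σ N (Φ N) τ χ g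
    (fun q : V3 × V3 × V3 => speedCutoff (max (max L₀ L₃) 1) ‖q.2.2 - q.2.1‖) r z with hDL
  set T := fun z => evenTubeTimeStat σ N (Φ N) τ χ g
    (fun q : V3 × V3 × V3 => speedCutoff (max (max L₀ L₃) 1) ‖q.2.2 - q.2.1‖) r (min (κ₂ / 2) (κ₃ / 2)) z with hT
  have E3' : P {z | η / 3 < |T z|} ≤ ENNReal.ofReal (δ / 3) := E3
  have hsub : {z | η < |D z|} ⊆
      ({z | η / 3 < |D z - DL z|} ∪ {z | η / 3 < |DL z - T z|}) ∪ {z | η / 3 < |T z|} := by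
    intro z hz
    simp only [Set.mem_setOf_eq, Set.mem_union] at hz ⊢
    by_contra hcon
    simp only [not_or, not_lt] at hcon
    obtain ⟨⟨h1, h2⟩, h3⟩ := hcon
    have i1 := abs_sub_abs_le_abs_sub (D z) (DL z)
    have i2 := abs_sub_abs_le_abs_sub (DL z) (T z)
    linarith
  calc P {z | η < |D z|}
      ≤ P (({z | η / 3 < |D z - DL z|} ∪ {z | η / 3 < |DL z - T z|}) ∪ {z | η / 3 < |T z|}) :=
        measure_mono hsub
    _ ≤ P ({z | η / 3 < |D z - DL z|} ∪ {z | η / 3 < |DL z - T z|}) + P {z | η / 3 < |T z|} :=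
        measure_union_le _ _
    _ ≤ (P {z | η / 3 < |D z - DL z|} + P {z | η / 3 < |DL z - T z|}) + P {z | η / 3 < |T z|} :=
        add_le_add (measure_union_le _ _) le_rfl
    _ ≤ (ENNReal.ofReal (δ / 3) + ENNReal.ofReal (δ / 3)) + ENNReal.ofReal (δ / 3) :=
        add_le_add (add_le_add E1 E2) E3'
    _ = ENNReal.ofReal δ := by
        rw [← ENNReal.ofReal_add hδ3.le hδ3.le, ← ENNReal.ofReal_add (by positivity) hδ3.le]
        congr 1
        ring

/-- **`CollisionRate ⇐ (A) ∧ T34p`.**  The crux `InformationPercolationEngine.CollisionRate` (stmt-AtomisticToContinuum-13481: the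
Enskog collision-frequency law `K_N[χ g(σ³ρ_r)] − σ³∫₀^τ∫ χ g Y(σ³ρ_r) B¹_r → 0` in probability under local Gibbs data, `N → ∞` then
`r → 0`) follows from the marginal envelope (A) of the evolved law and the kinetic core in probability T34p — through
`stub_evenStatOne_of_evenTubeTimeStatProb` and the bridge `collisionRate_of_evenStat_one`.  Both hypotheses are OPEN (a-priori
class / Boltzmann–Enskog class); this records that the crux is at most as hard as their conjunction. [folklore] -/
theorem collisionRate_of_marginalEnvelope_of_evenTubeTimeStatProb :
    (∀ (a₀ θ₀ : T3 → ℝ) (u₀ : T3 → V3), Continuous a₀ → Continuous θ₀ → Continuous u₀ →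
      (∀ x, 0 < a₀ x) → (∀ x, 0 < θ₀ x) → ∃ σ₀ : ℝ, 0 < σ₀ ∧ ∀ σ : ℝ, 0 < σ → σ < σ₀ →
      ∀ Φ : (N : ℕ) → HardSphereFlow (Torus.geometry (Fin 3)) (hsDiameter σ N) (N + 1),
      ∀ τ : ℝ, 0 < τ → ∃ C : ℝ, 0 ≤ C ∧ ∃ u : V3, ∃ θ : ℝ, 0 < θ ∧ ∃ N₀ : ℕ, ∀ N : ℕ, N₀ ≤ N →
      ∀ t ∈ Set.Icc (0 : ℝ) τ,
        (∀ i j : Fin (N + 1), i ≠ j → ∀ f : (T3 × V3) × (T3 × V3) → ℝ≥0∞, Measurable f →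
          ∫⁻ z, f ((Φ N).flow t z i, (Φ N).flow t z j) ∂(localGibbsLaw σ a₀ u₀ θ₀ N (Φ N)) ≤
            ENNReal.ofReal C * ∫⁻ q, f q ∂(((volume : Measure T3).prod (gaussMeasure u θ)).prod
              ((volume : Measure T3).prod (gaussMeasure u θ)))) ∧
        (∀ i j k : Fin (N + 1), i ≠ j → i ≠ k → j ≠ k → ∀ f : (T3 × V3) × (T3 × V3) × (T3 × V3) → ℝ≥0∞, Measurable f →
          ∫⁻ z, f ((Φ N).flow t z i, (Φ N).flow t z j, (Φ N).flow t z k) ∂(localGibbsLaw σ a₀ u₀ θ₀ N (Φ N)) ≤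
            ENNReal.ofReal C * ∫⁻ q, f q ∂(((volume : Measure T3).prod (gaussMeasure u θ)).prod
              (((volume : Measure T3).prod (gaussMeasure u θ)).prod ((volume : Measure T3).prod (gaussMeasure u θ)))))) →
    (∃ η₀ : ℝ, 0 < η₀ ∧ ∀ (a₀ θ₀ : T3 → ℝ) (u₀ : T3 → V3), Continuous a₀ → Continuous θ₀ → Continuous u₀ →
      (∀ x, 0 < a₀ x) → (∀ x, 0 < θ₀ x) → ∃ σ₀ : ℝ, 0 < σ₀ ∧ ∀ σ : ℝ, 0 < σ → σ < σ₀ →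
      ∀ Φ : (N : ℕ) → HardSphereFlow (Torus.geometry (Fin 3)) (hsDiameter σ N) (N + 1),
      ∀ τ : ℝ, 0 < τ → ∀ χ : ℝ × T3 → ℝ, Continuous χ → ∀ g : ℝ → ℝ, Continuous g →
      (∀ x, η₀ ≤ x → g x = 0) →
      ∀ η δ : ℝ, 0 < η → 0 < δ → ∃ r₀ : ℝ, 0 < r₀ ∧ ∀ r : ℝ, 0 < r → r < r₀ →
      ∃ L₀ : ℝ, ∀ L : ℝ, L₀ ≤ L → ∃ κ₀ : ℝ, 0 < κ₀ ∧ ∀ κ : ℝ, 0 < κ → κ < κ₀ → ∃ N₀ : ℕ, ∀ N : ℕ, N₀ ≤ N →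
        localGibbsLaw σ a₀ u₀ θ₀ N (Φ N)
          {z | η < |evenTubeTimeStat σ N (Φ N) τ χ g (fun q : V3 × V3 × V3 => speedCutoff L ‖q.2.2 - q.2.1‖) r κ z|}
          ≤ ENNReal.ofReal δ) →
    CollisionRate :=
  fun hA h => collisionRate_of_evenStat_one (stub_evenStatOne_of_evenTubeTimeStatProb hA h)

end

end Summit.AtomisticToContinuum.HydrodynamicLimit.Theorems.CollisionRate
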